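import Literature.NumberTheory.LFunctions.WeilTwoPrimeOddMarginIBase
import Literature.NumberTheory.LFunctions.WeilTwoPrimeOddMarginIDataP7
import Literature.NumberTheory.LFunctions.WeilBlockRowsPZ
import HarnessLib

/-!
# Two-prime odd-margin certificate I: dominance of rows 15–19 of `R = S'_odd(κ') − UᵀU` (factored data)

`WeilCert.checkDomRowPZ` with the materialized block `weilCert23IPm`, the factored inverse `weilCert23FDn/weilCert23FLs` (certificate F's, re-used) and the Bessel block `weilCert23IHp`, by `decide +kernel` row by row; converted to `checkDomRow` by `WeilCert.checkDomRow_of_PZ` in the assembly file. Pure proof file.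
-/

noncomputable section

namespace Literature.NumberTheory.LFunctions

set_option maxHeartbeats 0 in
/-- Kernel check of the dominance of row 15 of `R` (certificate I, factored data). [folklore] -/
theorem checkDomRowPZ1_15_weilCert23I :
    weilCert23IBase.checkDomRowPZ weilCert23IPm weilCert23FDn weilCert23FLs weilCert23IHp weilCert23IKappa' 1 15 = true := by
  decide +kernel

set_option maxHeartbeats 0 in
/-- Kernel check of the dominance of row 16 of `R` (certificate I, factored data). [folklore] -/
theorem checkDomRowPZ1_16_weilCert23I :
    weilCert23IBase.checkDomRowPZ weilCert23IPm weilCert23FDn weilCert23FLs weilCert23IHp weilCert23IKappa' 1 16 = true := by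
  decide +kernel

set_option maxHeartbeats 0 in
/-- Kernel check of the dominance of row 17 of `R` (certificate I, factored data). [folklore] -/
theorem checkDomRowPZ1_17_weilCert23I :
    weilCert23IBase.checkDomRowPZ weilCert23IPm weilCert23FDn weilCert23FLs weilCert23IHp weilCert23IKappa' 1 17 = true := by
  decide +kernel

set_option maxHeartbeats 0 in
/-- Kernel check of the dominance of row 18 of `R` (certificate I, factored data). [folklore] -/
theorem checkDomRowPZ1_18_weilCert23I :
    weilCert23IBase.checkDomRowPZ weilCert23IPm weilCert23FDn weilCert23FLs weilCert23IHp weilCert23IKappa' 1 18 = true := by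
  decide +kernel

set_option maxHeartbeats 0 in
/-- Kernel check of the dominance of row 19 of `R` (certificate I, factored data). [folklore] -/
theorem checkDomRowPZ1_19_weilCert23I :
    weilCert23IBase.checkDomRowPZ weilCert23IPm weilCert23FDn weilCert23FLs weilCert23IHp weilCert23IKappa' 1 19 = true := by
  decide +kernel

end Literature.NumberTheory.LFunctions
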